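/-
Copyright: the b2b-balaban T⁴-continuum CRUX team, row NE7b OWNER lineage `t4-ne7b-p1` (gen 128). Project licence.
-/
import Summits.QuantumFields.BalabanUV.T4Continuum.Spine.NE7b.SupLargeFieldCellsRare

/-!
# LARGE-FIELD REGIONS THROUGH A CELL ARE RARE, SUMMED OVER ALL SHAPES (the Peierls SUM): under `N(0,Γ)` with `Γ ⪯ γ_op·1`, diagonal
# `≤ γ`, disjoint cells of `≤ v` sites and an adjacency `R` with `≤ Δ` neighbours, for EVERY finite family `𝒴` of `R`-connected cell sets
# containing a fixed cell `q`: `Σ_{L∈𝒴} P(∀ p ∈ L, Σ_{x∈cell p}ω_x² ≥ Ψ²) ≤ 2η` and `P(∃ L ∈ 𝒴, all cells of L large) ≤ 2η`,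
# `η = e^{−½κΨ²}·A^v`, whenever `(Δ+1)²η ≤ ½` — (294)'s per-shape bound `η^{#L}` resummed by the tree's lattice-animal estimate; NO volume
# factor, contrast (285)'s union bound (row NE7b, node U5c; (294) + `PolymerGasGeometric.sum_pow_card_le_of_connected` BY NAME; [folklore])

Cell `pub-balaban`, sub-cell `t4`, spine estimate NE7b (`T4WeightBudget.RelWeightBound`; the cell's OWN estimate — NOT PRINTED in
[Bałaban 1983–89], NOT PROVED).  Crux-route work under `Spine/NE7b/` by the row OWNER (`t4-ne7b-p1` gen 128, file (304)) under FREEZE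
(0)'s crux-prover clause, on § [NE7bP1-G128-HANDOFF] NEXT (3)(b) («the large-field REGIONS: resum (294) against the entropy of L-families»);
NOTHING of Bałaban's is named as a Lean object, valued or asserted; no `T4Continuum/Support` leaf typed; no `def`, no notation; zero `sorry`.
Imports (BY NAME): the OWNER's (294) `…SupLargeFieldCellsRare` (`measureReal_largeCells_le`), the tree's
`Literature/Probability/LatticeModels/PolymerGasGeometric` (`sum_pow_card_le_of_connected`: `Σ_{Y∈𝒴}λ^{#Y} ≤ 2λ` for families of
`R`-connected sets through a cell when `(Δ+1)²λ ≤ ½`), Mathlib's `measureReal_biUnion_finset_le`.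

WHY (located).  (294) prices ONE prescribed family of large cells; the large-field REGION containing a given cell can have any connected
shape, so the usable estimate is the SUM over shapes — a Peierls argument whose entropy factor is the lattice-animal count.  The tree has
exactly that count in the form `Σλ^{#Y} ≤ 2λ`; with `λ = η` from (294) the region estimate follows in three lines and is LOCAL (no `#σ`).

WHAT IS PROVED ([folklore]):
* §1 **`sum_measureReal_largeRegions_le`** (the Peierls sum `≤ 2η`), **`measureReal_exists_largeRegion_le`** (the union over the family
  `≤ 2η`);
* §2 `eta_small_of` (bookkeeping: a sufficient condition for `(Δ+1)²η ≤ ½` from `e^{−½κΨ²} ≤ δ` and `(Δ+1)²A^vδ ≤ ½`); §3 toy.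

HONEST (what this is NOT).  The families `𝒴` are supplied by the consumer (e.g. all `R`-connected cell sets through `q` inside a volume — the
bound is uniform in the family); coupling with (296)∕(297) into the all-`ψ` assembly is the successor's; one scale; scalar skeleton ((A3),
NC-NE7b-α UNRULED); nothing of Bałaban's asserted.  BY-NAME EFFECT ON THE WALL: NONE.  NE7b NOT PRINTED ∕ NOT PROVED; spine PROVED 0∕9; rung
(B)+1 — the programme's measures remain FINITE-torus statements; NOT the mass gap, NOT Clay.  HONEST DEPENDENCY: continuum YM on T⁴ ⇐ BetaPertH
∧ nine spine estimates (0∕9 proved); BetaPertH ⇐ (D1) ∧ (D4) ∧ CAP+tail; G-an2-4 gates asym, D1 and NE2∕3∕4.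
-/

set_option autoImplicit false

noncomputable section

namespace Summit.QuantumFields.BalabanUV.T4Continuum.NE7b.SupLargeFieldRegionsRare

open MeasureTheory ProbabilityTheory Finset Real
open scoped BigOperators
open Literature.Probability.LatticeModels (IsRConnected sum_pow_card_le_of_connected)
open SupLargeFieldCellsRare (measureReal_largeCells_le)

variable {ι : Type} [Fintype ι] [DecidableEq ι] {V : Type*} [DecidableEq V]

/-! ## §1. The Peierls sum over region shapes -/

/-- **THE PEIERLS SUM**: `Γ ⪰ 0`, `Γ ⪯ γ_op·1`, diagonal `≤ γ` (`γ ≥ 0`); disjoint cells of `≤ v` sites; `R` symmetric with `≤ Δ` neighbours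
listed by `nbr`; `0 ≤ κ`, `0 < θ < 1`, `κγ_op ≤ θ`; `η = e^{−½κΨ²}A^v` with `(Δ+1)²η ≤ ½` ⟹ for every cell `q` and every finite family `𝒴` of
`R`-connected cell sets containing `q`: `Σ_{L∈𝒴} P(∀ p ∈ L, Ψ² ≤ Σ_{x∈cell p}ω_x²) ≤ 2η`. [folklore] -/
theorem sum_measureReal_largeRegions_le {Γ : Matrix ι ι ℝ} {γop γ : ℝ} (hΓ : Γ.PosSemidef)
    (hΓop : (γop • (1 : Matrix ι ι ℝ) - Γ).PosSemidef) (hdiag : ∀ i, Γ i i ≤ γ) (hγ : 0 ≤ γ) (cell : V → Finset ι)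
    (hdisj : ∀ p q, p ≠ q → Disjoint (cell p) (cell q)) {v : ℕ} (hv : ∀ p, (cell p).card ≤ v) {R : V → V → Prop}
    (hR : ∀ x y, R x y → R y x) {nbr : V → Finset V} {Δ : ℕ} (hΔ : ∀ x, (nbr x).card ≤ Δ) (hnbr : ∀ x y, R x y → y ∈ nbr x)
    {κ θ : ℝ} (hκ : 0 ≤ κ) (hθ0 : 0 < θ) (hθ1 : θ < 1) (hκθ : κ * γop ≤ θ) (Ψ : ℝ)
    (hsmall : ((Δ : ℝ) + 1) ^ 2 * (exp (-(κ * Ψ ^ 2 / 2)) * ((1 - θ) ^ (-(κ * γ / (2 * θ)))) ^ v) ≤ 1 / 2)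
    (q : V) (𝒴 : Finset (Finset V)) (h𝒴 : ∀ L ∈ 𝒴, q ∈ L ∧ IsRConnected R L) :
    ∑ L ∈ 𝒴, (multivariateGaussian 0 Γ).real {ω : EuclideanSpace ℝ ι | ∀ p ∈ L, Ψ ^ 2 ≤ ∑ x ∈ cell p, ω x ^ 2} ≤
      2 * (exp (-(κ * Ψ ^ 2 / 2)) * ((1 - θ) ^ (-(κ * γ / (2 * θ)))) ^ v) := by
  set η : ℝ := exp (-(κ * Ψ ^ 2 / 2)) * ((1 - θ) ^ (-(κ * γ / (2 * θ)))) ^ v with hη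
  have hη0 : 0 ≤ η := mul_nonneg (exp_pos _).le (pow_nonneg (rpow_nonneg (by linarith) _) _)
  calc ∑ L ∈ 𝒴, (multivariateGaussian 0 Γ).real {ω : EuclideanSpace ℝ ι | ∀ p ∈ L, Ψ ^ 2 ≤ ∑ x ∈ cell p, ω x ^ 2}
      ≤ ∑ L ∈ 𝒴, η ^ L.card :=
        sum_le_sum fun L _ => measureReal_largeCells_le hΓ hΓop hdiag hγ cell hdisj hv hκ hθ0 hθ1 hκθ L Ψ
    _ ≤ 2 * η := sum_pow_card_le_of_connected hR hΔ hnbr hη0 hsmall q 𝒴 h𝒴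

/-- **A CELL BELONGS TO SOME LARGE-FIELD REGION OF THE FAMILY WITH PROBABILITY `≤ 2η`**: under the same hypotheses,
`P(∃ L ∈ 𝒴, ∀ p ∈ L, Ψ² ≤ Σ_{x∈cell p}ω_x²) ≤ 2η` — a LOCAL estimate, with no volume factor. [folklore] -/
theorem measureReal_exists_largeRegion_le {Γ : Matrix ι ι ℝ} {γop γ : ℝ} (hΓ : Γ.PosSemidef)
    (hΓop : (γop • (1 : Matrix ι ι ℝ) - Γ).PosSemidef) (hdiag : ∀ i, Γ i i ≤ γ) (hγ : 0 ≤ γ) (cell : V → Finset ι)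
    (hdisj : ∀ p q, p ≠ q → Disjoint (cell p) (cell q)) {v : ℕ} (hv : ∀ p, (cell p).card ≤ v) {R : V → V → Prop}
    (hR : ∀ x y, R x y → R y x) {nbr : V → Finset V} {Δ : ℕ} (hΔ : ∀ x, (nbr x).card ≤ Δ) (hnbr : ∀ x y, R x y → y ∈ nbr x)
    {κ θ : ℝ} (hκ : 0 ≤ κ) (hθ0 : 0 < θ) (hθ1 : θ < 1) (hκθ : κ * γop ≤ θ) (Ψ : ℝ)
    (hsmall : ((Δ : ℝ) + 1) ^ 2 * (exp (-(κ * Ψ ^ 2 / 2)) * ((1 - θ) ^ (-(κ * γ / (2 * θ)))) ^ v) ≤ 1 / 2)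
    (q : V) (𝒴 : Finset (Finset V)) (h𝒴 : ∀ L ∈ 𝒴, q ∈ L ∧ IsRConnected R L) :
    (multivariateGaussian 0 Γ).real {ω : EuclideanSpace ℝ ι | ∃ L ∈ 𝒴, ∀ p ∈ L, Ψ ^ 2 ≤ ∑ x ∈ cell p, ω x ^ 2} ≤
      2 * (exp (-(κ * Ψ ^ 2 / 2)) * ((1 - θ) ^ (-(κ * γ / (2 * θ)))) ^ v) := by
  have hU : {ω : EuclideanSpace ℝ ι | ∃ L ∈ 𝒴, ∀ p ∈ L, Ψ ^ 2 ≤ ∑ x ∈ cell p, ω x ^ 2} =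
      ⋃ L ∈ 𝒴, {ω : EuclideanSpace ℝ ι | ∀ p ∈ L, Ψ ^ 2 ≤ ∑ x ∈ cell p, ω x ^ 2} := by
    ext ω
    simp only [Set.mem_setOf_eq, Set.mem_iUnion, exists_prop]
  rw [hU]
  exact (measureReal_biUnion_finset_le _ _).trans
    (sum_measureReal_largeRegions_le hΓ hΓop hdiag hγ cell hdisj hv hR hΔ hnbr hκ hθ0 hθ1 hκθ Ψ hsmall q 𝒴 h𝒴)

/-! ## §2. Bookkeeping: when is `η` small -/

/-- `(Δ+1)²η ≤ ½` follows from `e^{−½κΨ²} ≤ δ`, `0 ≤ A`, and `(Δ+1)²·A^v·δ ≤ ½`. [folklore] -/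
theorem eta_small_of {Δ v : ℕ} {κ Ψ A δ : ℝ} (hA : 0 ≤ A) (hexp : exp (-(κ * Ψ ^ 2 / 2)) ≤ δ)
    (hδ : ((Δ : ℝ) + 1) ^ 2 * A ^ v * δ ≤ 1 / 2) :
    ((Δ : ℝ) + 1) ^ 2 * (exp (-(κ * Ψ ^ 2 / 2)) * A ^ v) ≤ 1 / 2 := by
  have h1 : 0 ≤ ((Δ : ℝ) + 1) ^ 2 * A ^ v := mul_nonneg (by positivity) (pow_nonneg hA _)
  calc ((Δ : ℝ) + 1) ^ 2 * (exp (-(κ * Ψ ^ 2 / 2)) * A ^ v) = ((Δ : ℝ) + 1) ^ 2 * A ^ v * exp (-(κ * Ψ ^ 2 / 2)) := by ring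
    _ ≤ ((Δ : ℝ) + 1) ^ 2 * A ^ v * δ := mul_le_mul_of_nonneg_left hexp h1
    _ ≤ 1 / 2 := hδ

/-! ## §3. Toy -/

/-- Toy (§2): with `Δ = 0`, `v = 0`, `A = 1` and `δ = ½`, any `κΨ² ≥ 2·log 2`-type tail `e^{−½κΨ²} ≤ ½` makes `η` small. -/
example {κ Ψ : ℝ} (h : exp (-(κ * Ψ ^ 2 / 2)) ≤ 1 / 2) :
    (((0 : ℕ) : ℝ) + 1) ^ 2 * (exp (-(κ * Ψ ^ 2 / 2)) * (1 : ℝ) ^ (0 : ℕ)) ≤ 1 / 2 :=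
  eta_small_of (v := 0) zero_le_one h (by norm_num)

end Summit.QuantumFields.BalabanUV.T4Continuum.NE7b.SupLargeFieldRegionsRare
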